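import Summits.SmoothPoincare4.SmoothPoincare4.Theorems.SullivanDualWitnessChargeDefs

/-!
# Sub-stub `substub_far` of the hard stub `stub_pencilOrRescale` — part 2: the far flat lines are
pencil members (crux `WitnessCharge`, stmt-SmoothPoincare4-7824, route `SullivanDual`, line
`Sketch`; card `Cruxes/WitnessCharge/Lines/Sketch.md`)

Continuing the Defs file (`SullivanDualWitnessChargeDefs.lean`, far flat lines `substub_farFlat`): the differential of the flat
coordinate map `ψ = ι ∘ (e − e p)` is injective on the punctured chart-ball (`ι` is an involution,
`e` a chart) and reads the far line as the affine map `ξ ↦ realify (ξ, b)`; hence the far line is an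
immersion, and for `J` STANDARD on the punctured `ε'`-ball (`⟪Dψ(Jv), c⟫ = ω₀(Dψ v, c)`, i.e.
`Dψ ∘ J = J₀ ∘ Dψ`) it is `J`-holomorphic (`Dψ` maps both `Du(iζ)` and `J(Du ζ)` to
`J₀(realify (ζ, 0))`). It is proper (a compact subset of `Σ∖p` misses a punctured chart-ball, while
`u ξ ∈ B_r` once `‖ξ‖² + ‖b‖² > r⁻²`). So it is a pencil member with intercept `b`
(`IsPencilMember`, Defs file), which proves the registered sub-stub
`substub_far : ∃ R₀, ∀ b, R₀ < ‖b‖ → b ∈ interceptSet J` (with `R₀ = ε'⁻¹`).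
-/

noncomputable section

-- the prescribed namespace `Summit.<P>.<Sub>.…` duplicates `SmoothPoincare4` (P = Sub)
set_option linter.dupNamespace false

open scoped Manifold ContDiff Topology
open Set Filter Literature.Geometry.Symplectic Literature.Topology.FourManifolds

namespace Summit.SmoothPoincare4.SmoothPoincare4.Theorems.WitnessCharge.PencilIncompleteness

variable {S : HomotopySphere 4}

section FarLine

variable {p : S.carrier} {ε' : ℝ} {b : ℂ} (hε' : 0 < ε')
  (hball : Metric.closedBall (extChartAt (𝓡 4) p p) ε' ⊆ (extChartAt (𝓡 4) p).target)
  (hb : ε'⁻¹ < ‖b‖)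
include hε' hball hb

/-! #### The flat coordinate map `ψ = ι ∘ (e − e p)` on `Σ ∖ p` and its differential -/

omit hε' hball hb in
/-- The recentred-inverted chart `ψ x = ι(e x − e p)` is differentiable at every point of the
punctured `ε'`-chart-ball, with differential `Dι(e x − e p) ∘ D(e ∘ val)(x)`. -/
theorem hasMFDerivAt_psi {x : punctured p} (hx : InPuncturedChartBall p ε' x) :
    HasMFDerivAt (𝓡 4) 𝓘(ℝ, EuclideanSpace ℝ (Fin 4))
      (fun z : punctured p => inversion (extChartAt (𝓡 4) p z.1 - extChartAt (𝓡 4) p p)) x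
      ((fderiv ℝ inversion (extChartAt (𝓡 4) p x.1 - extChartAt (𝓡 4) p p)).comp
        (mfderiv (𝓡 4) 𝓘(ℝ, EuclideanSpace ℝ (Fin 4))
          (fun z : punctured p => extChartAt (𝓡 4) p z.1) x)) := by
  have hne : extChartAt (𝓡 4) p x.1 - extChartAt (𝓡 4) p p ≠ 0 := by
    intro h0
    have h1 : extChartAt (𝓡 4) p x.1 = extChartAt (𝓡 4) p p := sub_eq_zero.1 h0
    have h2 : x.1 = p :=
      (extChartAt (𝓡 4) p).injOn (by rw [extChartAt_source]; exact hx.1)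
        (mem_extChartAt_source (I := 𝓡 4) p) h1
    exact (mem_punctured.1 x.2) h2
  have hE : ContMDiffAt (𝓡 4) 𝓘(ℝ, EuclideanSpace ℝ (Fin 4)) ∞
      (fun z : punctured p => extChartAt (𝓡 4) p z.1) x :=
    (contMDiffAt_extChartAt' (I := 𝓡 4) (n := ∞) hx.1).comp x
      (contMDiff_subtype_val (I := 𝓡 4) (n := ∞) (U := punctured p) x)
  have hEx : MDifferentiableAt (𝓡 4) 𝓘(ℝ, EuclideanSpace ℝ (Fin 4))
      (fun z : punctured p => extChartAt (𝓡 4) p z.1) x := hE.mdifferentiableAt (by simp)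
  have hg : HasFDerivAt (fun y : EuclideanSpace ℝ (Fin 4) => inversion (y - extChartAt (𝓡 4) p p))
      (fderiv ℝ inversion (extChartAt (𝓡 4) p x.1 - extChartAt (𝓡 4) p p))
      (extChartAt (𝓡 4) p x.1) := by
    have h1 : HasFDerivAt inversion
        (fderiv ℝ inversion (extChartAt (𝓡 4) p x.1 - extChartAt (𝓡 4) p p))
        (extChartAt (𝓡 4) p x.1 - extChartAt (𝓡 4) p p) :=
      (differentiableAt_inversion hne).hasFDerivAt
    have h2 := h1.comp (extChartAt (𝓡 4) p x.1) (hasFDerivAt_sub_const (extChartAt (𝓡 4) p p))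
    rwa [ContinuousLinearMap.comp_id] at h2
  exact HasMFDerivAt.comp x
    (g := fun y : EuclideanSpace ℝ (Fin 4) => inversion (y - extChartAt (𝓡 4) p p))
    (f := fun z : punctured p => extChartAt (𝓡 4) p z.1) hg.hasMFDerivAt hEx.hasMFDerivAt

omit hε' hball hb in
/-- The differential `Dι(e x − e p) ∘ D(e ∘ val)(x)` of `ψ` is injective on the punctured
`ε'`-chart-ball (`ι` is an involution, `e` a chart). -/
theorem injective_Dpsi {x : punctured p} (hx : InPuncturedChartBall p ε' x) :
    Function.Injective
      ((fderiv ℝ inversion (extChartAt (𝓡 4) p x.1 - extChartAt (𝓡 4) p p)).comp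
        (mfderiv (𝓡 4) 𝓘(ℝ, EuclideanSpace ℝ (Fin 4))
          (fun z : punctured p => extChartAt (𝓡 4) p z.1) x)) := by
  set y : EuclideanSpace ℝ (Fin 4) := extChartAt (𝓡 4) p x.1 - extChartAt (𝓡 4) p p with hy
  have hne : y ≠ 0 := by
    intro h0
    have h1 : extChartAt (𝓡 4) p x.1 = extChartAt (𝓡 4) p p := sub_eq_zero.1 h0
    have h2 : x.1 = p :=
      (extChartAt (𝓡 4) p).injOn (by rw [extChartAt_source]; exact hx.1)
        (mem_extChartAt_source (I := 𝓡 4) p) h1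
    exact (mem_punctured.1 x.2) h2
  -- `Dι(ι y) ∘ Dι(y) = id`
  have hι : Function.Injective (fderiv ℝ inversion y) := by
    have h1 : HasFDerivAt inversion (fderiv ℝ inversion y) y :=
      (differentiableAt_inversion hne).hasFDerivAt
    have h2 : HasFDerivAt inversion (fderiv ℝ inversion (inversion y)) (inversion y) :=
      (differentiableAt_inversion (inversion_ne_zero hne)).hasFDerivAt
    have h3 : HasFDerivAt (inversion ∘ inversion)
        ((fderiv ℝ inversion (inversion y)).comp (fderiv ℝ inversion y)) y := h2.comp y h1
    have h4 : HasFDerivAt (inversion ∘ inversion : EuclideanSpace ℝ (Fin 4) → EuclideanSpace ℝ (Fin 4))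
        (ContinuousLinearMap.id ℝ _) y := by
      have : (inversion ∘ inversion : EuclideanSpace ℝ (Fin 4) → EuclideanSpace ℝ (Fin 4)) = id := by
        funext z; exact inversion_inversion z
      rw [this]; exact hasFDerivAt_id y
    have h5 := h3.unique h4
    intro a a' h
    have := congrArg (fderiv ℝ inversion (inversion y)) h
    rw [← ContinuousLinearMap.comp_apply, ← ContinuousLinearMap.comp_apply, h5] at this
    simpa using this
  -- `D(e ∘ val)(x) = De(x.1) ∘ id` is invertible
  have hval : mfderiv (𝓡 4) 𝓘(ℝ, EuclideanSpace ℝ (Fin 4))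
      (fun z : punctured p => extChartAt (𝓡 4) p z.1) x =
      (mfderiv (𝓡 4) 𝓘(ℝ, EuclideanSpace ℝ (Fin 4)) (extChartAt (𝓡 4) p) x.1).comp
        (mfderiv (𝓡 4) (𝓡 4) (Subtype.val : punctured p → S.carrier) x) := by
    have hsrc : x.1 ∈ (extChartAt (𝓡 4) p).source := by rw [extChartAt_source]; exact hx.1
    have he : MDifferentiableAt (𝓡 4) 𝓘(ℝ, EuclideanSpace ℝ (Fin 4)) (extChartAt (𝓡 4) p) x.1 :=
      ((contMDiffAt_extChartAt' (I := 𝓡 4) (n := ∞) hx.1).mdifferentiableAt (by simp))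
    exact mfderiv_comp x he
      (Literature.Geometry.Manifold.OpenSubmanifold.mdifferentiableAt_subtype_val x)
  have hsrc : x.1 ∈ (extChartAt (𝓡 4) p).source := by rw [extChartAt_source]; exact hx.1
  have hinv := isInvertible_mfderiv_extChartAt (I := 𝓡 4) hsrc
  intro a a' h
  simp only [ContinuousLinearMap.comp_apply] at h
  have h' := hι h
  rw [hval] at h'
  simp only [Literature.Geometry.Manifold.OpenSubmanifold.mfderiv_subtype_val] at h'
  exact hinv.injective h'


/-! #### The differential of the far line in flat coordinates -/

/-- In flat coordinates the far line is the affine map `ξ ↦ realify (ξ, b)`: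
`Dψ(u ξ) ∘ Du(ξ) = realify ∘ (ζ ↦ (ζ, 0))`. -/
theorem Dpsi_comp_mfderiv_farLine (ξ : ℂ) :
    ((fderiv ℝ inversion (extChartAt (𝓡 4) p (farLine hε' hball hb ξ).1 - extChartAt (𝓡 4) p p)).comp
        (mfderiv (𝓡 4) 𝓘(ℝ, EuclideanSpace ℝ (Fin 4))
          (fun z : punctured p => extChartAt (𝓡 4) p z.1) (farLine hε' hball hb ξ))).comp
      (mfderiv 𝓘(ℝ, ℂ) (𝓡 4) (farLine hε' hball hb) ξ) =
    realifyL.comp (ContinuousLinearMap.inl ℝ ℂ ℂ) := by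
  have hu : HasMFDerivAt 𝓘(ℝ, ℂ) (𝓡 4) (farLine hε' hball hb) ξ
      (mfderiv 𝓘(ℝ, ℂ) (𝓡 4) (farLine hε' hball hb) ξ) :=
    ((contMDiff_farLine hε' hball hb).mdifferentiableAt (by simp)).hasMFDerivAt
  have h1 := (hasMFDerivAt_psi (farLine_mem_ball hε' hball hb ξ)).comp ξ hu
  have hfun : ((fun z : punctured p => inversion (extChartAt (𝓡 4) p z.1 - extChartAt (𝓡 4) p p)) ∘
      farLine hε' hball hb) = fun ξ : ℂ => realify (ξ, b) :=
    funext fun ξ => inversion_farLine hε' hball hb ξ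
  rw [hfun] at h1
  have h2 : HasMFDerivAt 𝓘(ℝ, ℂ) 𝓘(ℝ, EuclideanSpace ℝ (Fin 4)) (fun ξ : ℂ => realify (ξ, b)) ξ
      (realifyL.comp (ContinuousLinearMap.inl ℝ ℂ ℂ)) := by
    rw [hasMFDerivAt_iff_hasFDerivAt]
    have hf : (fun ξ : ℂ => realify (ξ, b)) =
        fun ξ => realifyL ((ContinuousLinearMap.inl ℝ ℂ ℂ) ξ + (0, b)) := by
      funext ξ; simp
    rw [hf]
    have h3 : HasFDerivAt (fun ξ : ℂ => (ContinuousLinearMap.inl ℝ ℂ ℂ) ξ + (0, b))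
        (ContinuousLinearMap.inl ℝ ℂ ℂ) ξ :=
      ((ContinuousLinearMap.inl ℝ ℂ ℂ).hasFDerivAt).add_const (0, b)
    exact realifyL.hasFDerivAt.comp ξ h3
  exact hasMFDerivAt_unique h1 h2

/-- Consequence: `Dψ(u ξ) (Du(ξ) ζ) = realify (ζ, 0)`. -/
theorem Dpsi_mfderiv_farLine_apply (ξ ζ : ℂ) :
    (fderiv ℝ inversion (extChartAt (𝓡 4) p (farLine hε' hball hb ξ).1 - extChartAt (𝓡 4) p p))
        (mfderiv (𝓡 4) 𝓘(ℝ, EuclideanSpace ℝ (Fin 4))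
          (fun z : punctured p => extChartAt (𝓡 4) p z.1) (farLine hε' hball hb ξ)
          (mfderiv 𝓘(ℝ, ℂ) (𝓡 4) (farLine hε' hball hb) ξ ζ)) = realify (ζ, 0) := by
  have h := ContinuousLinearMap.ext_iff.1 (Dpsi_comp_mfderiv_farLine hε' hball hb ξ) ζ
  simp only [ContinuousLinearMap.comp_apply] at h
  exact h

/-- The far line is an immersion. -/
theorem injective_mfderiv_farLine (ξ : ℂ) :
    Function.Injective (mfderiv 𝓘(ℝ, ℂ) (𝓡 4) (farLine hε' hball hb) ξ) := by
  intro ζ ζ' h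
  have h1 := Dpsi_mfderiv_farLine_apply hε' hball hb ξ ζ
  have h2 := Dpsi_mfderiv_farLine_apply hε' hball hb ξ ζ'
  rw [h] at h1
  have h3 : realify (ζ, 0) = realify (ζ', 0) := h1.symm.trans h2
  exact congrArg Prod.fst (realify_injective h3)

/-! #### `J`-holomorphicity from standardness of `J` on the punctured `ε'`-ball -/

/-- If `J` is standard on the punctured `ε'`-chart-ball (`⟪Dψ (J v), c⟫ = ω₀(Dψ v, c)`), the far line
is `J`-holomorphic: both `Du(iζ)` and `J (Du ζ)` are mapped by the injective `Dψ` to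
`J₀ (realify (ζ, 0)) = realify (iζ, 0)`. -/
theorem isJHolomorphic_farLine
    (J : ∀ x : punctured p, TangentSpace (𝓡 4) x →L[ℝ] TangentSpace (𝓡 4) x)
    (hJstd : ∀ x : punctured p, InPuncturedChartBall p ε' x →
      ∀ (v : TangentSpace (𝓡 4) x) (c : EuclideanSpace ℝ (Fin 4)),
        inner ℝ (fderiv ℝ inversion (extChartAt (𝓡 4) p x.1 - extChartAt (𝓡 4) p p)
          (mfderiv (𝓡 4) 𝓘(ℝ, EuclideanSpace ℝ (Fin 4))
            (fun z : punctured p => extChartAt (𝓡 4) p z.1) x (J x v))) c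
        = stdSymplecticForm (fderiv ℝ inversion (extChartAt (𝓡 4) p x.1 - extChartAt (𝓡 4) p p)
          (mfderiv (𝓡 4) 𝓘(ℝ, EuclideanSpace ℝ (Fin 4))
            (fun z : punctured p => extChartAt (𝓡 4) p z.1) x v)) c) :
    IsJHolomorphic (𝓡 4) J (farLine hε' hball hb) := by
  intro ξ ζ
  have hx : InPuncturedChartBall p ε' (farLine hε' hball hb ξ) := farLine_mem_ball hε' hball hb ξ
  apply injective_Dpsi hx
  simp only [ContinuousLinearMap.comp_apply]
  have h1 := Dpsi_mfderiv_farLine_apply hε' hball hb ξ (Complex.I * ζ)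
  have h2 := Dpsi_mfderiv_farLine_apply hε' hball hb ξ ζ
  -- standardness: `Dψ (J v) = J₀ (Dψ v)` for `v = Du ζ`
  have h3 : fderiv ℝ inversion
        (extChartAt (𝓡 4) p (farLine hε' hball hb ξ).1 - extChartAt (𝓡 4) p p)
        (mfderiv (𝓡 4) 𝓘(ℝ, EuclideanSpace ℝ (Fin 4))
          (fun z : punctured p => extChartAt (𝓡 4) p z.1) (farLine hε' hball hb ξ)
          (J (farLine hε' hball hb ξ) (mfderiv 𝓘(ℝ, ℂ) (𝓡 4) (farLine hε' hball hb) ξ ζ))) =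
      J0 (realify (ζ, 0)) := by
    apply eq_of_inner_eq
    intro c
    rw [hJstd _ hx _ c, inner_J0, h2]
  exact h1.trans ((realify_I_mul ζ).trans h3.symm)

/-! #### Properness -/

omit hε' hball hb in
/-- A compact subset of `Σ ∖ p` misses a punctured chart-ball at `p`. -/
theorem exists_ball_disjoint_of_isCompact {K : Set (punctured p)} (hK : IsCompact K) :
    ∃ ρ : ℝ, 0 < ρ ∧ ∀ x : punctured p, InPuncturedChartBall p ρ x → x ∉ K := by
  have hKM : IsCompact (((↑) : punctured p → S.carrier) '' K) := hK.image continuous_subtype_val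
  have hpK : p ∉ ((↑) : punctured p → S.carrier) '' K := by
    rintro ⟨x, -, hx⟩
    exact (mem_punctured.1 x.2) hx
  have hnhds : (((↑) : punctured p → S.carrier) '' K)ᶜ ∈ 𝓝 p :=
    hKM.isClosed.isOpen_compl.mem_nhds hpK
  obtain ⟨ρ, hρ, hρsub⟩ :=
    Metric.mem_nhds_iff.1 (extChartAt_preimage_mem_nhds (I := 𝓡 4) hnhds)
  refine ⟨ρ, hρ, fun x hx hxK => ?_⟩
  have h1 : (extChartAt (𝓡 4) p).symm (extChartAt (𝓡 4) p x.1) = x.1 :=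
    (extChartAt (𝓡 4) p).left_inv (by rw [extChartAt_source]; exact hx.1)
  have h2 := hρsub hx.2
  rw [mem_preimage, h1] at h2
  exact h2 ⟨x, hxK, rfl⟩

/-- The far line is proper: preimages of compact sets are compact (they are closed and bounded,
since a compact set misses a punctured chart-ball `B_ρ` while `u ξ ∈ B_r` as soon as
`‖ξ‖² + ‖b‖² > r⁻²`). -/
theorem isCompact_preimage_farLine {K : Set (punctured p)} (hK : IsCompact K) :
    IsCompact (farLine hε' hball hb ⁻¹' K) := by
  obtain ⟨ρ, hρ, hρK⟩ := exists_ball_disjoint_of_isCompact hK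
  have hclosed : IsClosed (farLine hε' hball hb ⁻¹' K) :=
    hK.isClosed.preimage (contMDiff_farLine hε' hball hb).continuous
  refine (isCompact_closedBall (0 : ℂ) ρ⁻¹).of_isClosed_subset hclosed fun ξ hξ => ?_
  rw [Metric.mem_closedBall, dist_zero_right]
  refine le_of_not_gt fun hlt => ?_
  apply hρK (farLine hε' hball hb ξ) _ hξ
  refine ⟨farPt_mem_source hε' hball hb ξ, ?_⟩
  show extChartAt (𝓡 4) p (farPt p b ξ) ∈ Metric.ball (extChartAt (𝓡 4) p p) ρ
  rw [extChartAt_farPt hε' hball hb ξ, Metric.mem_ball, dist_eq_norm, add_sub_cancel_left,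
    norm_inversion]
  have hξ' : ρ⁻¹ < ‖realify (ξ, b)‖ := by
    have h := norm_realify_sq (ξ, b)
    simp only at h
    have hρinv : 0 < ρ⁻¹ := inv_pos.2 hρ
    nlinarith [norm_nonneg (realify (ξ, b)), norm_nonneg ξ, norm_nonneg b]
  have hpos : 0 < ‖realify (ξ, b)‖ := (inv_pos.2 hρ).trans hξ'
  exact (inv_lt_comm₀ hpos hρ).2 hξ'


/-! #### The far line is a pencil member -/

/-- For `J` standard on the punctured `ε'`-chart-ball, the far line of intercept `b`,
`‖b‖ > ε'⁻¹`, is a pencil member with intercept `b`. -/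
theorem isPencilMember_farLine
    (J : ∀ x : punctured p, TangentSpace (𝓡 4) x →L[ℝ] TangentSpace (𝓡 4) x)
    (hJstd : ∀ x : punctured p, InPuncturedChartBall p ε' x →
      ∀ (v : TangentSpace (𝓡 4) x) (c : EuclideanSpace ℝ (Fin 4)),
        inner ℝ (fderiv ℝ inversion (extChartAt (𝓡 4) p x.1 - extChartAt (𝓡 4) p p)
          (mfderiv (𝓡 4) 𝓘(ℝ, EuclideanSpace ℝ (Fin 4))
            (fun z : punctured p => extChartAt (𝓡 4) p z.1) x (J x v))) c
        = stdSymplecticForm (fderiv ℝ inversion (extChartAt (𝓡 4) p x.1 - extChartAt (𝓡 4) p p)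
          (mfderiv (𝓡 4) 𝓘(ℝ, EuclideanSpace ℝ (Fin 4))
            (fun z : punctured p => extChartAt (𝓡 4) p z.1) x v)) c) :
    IsPencilMember J (farLine hε' hball hb) b := by
  refine ⟨⟨contMDiff_farLine hε' hball hb, ⟨0, 1, fun h => ?_⟩,
    isJHolomorphic_farLine hε' hball hb J hJstd⟩, farLine_injective hε' hball hb,
    injective_mfderiv_farLine hε' hball hb, fun K hK => isCompact_preimage_farLine hε' hball hb hK,
    ?_, ?_⟩
  · exact zero_ne_one (farLine_injective hε' hball hb h)
  · simp only [Ycoord_farLine, sub_self]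
    exact tendsto_const_nhds
  · simp only [Ycoord_farLine]
    exact tendsto_const_nhds

end FarLine

/-! ### The sub-stub -/

/-- **Sub-stub (C-far) of `stub_pencilOrRescale`: the honest far flat lines are pencil members.**
For `J` standard on the punctured `ε'`-chart-ball at `p` (closed `ε'`-ball inside the chart
target), every intercept `b` with `‖b‖ > ε'⁻¹` is realised: the flat line `w = b` of the end,
`ξ ↦ e⁻¹(e p + ι(realify (ξ, b)))`, is a proper, injective, immersed, non-constant `C^∞`
`J`-holomorphic plane with the required asymptotics (indeed `Ycoord ∘ u = (·, b)` exactly).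
(Line `Sketch`, `Lines/Sketch.md` Definition paragraph: `Ω ⊇ {|b| > R₀}`.) -/
theorem substub_far :
    ∀ (S : HomotopySphere 4) (p : S.carrier)
      (J : ∀ x : punctured p, TangentSpace (𝓡 4) x →L[ℝ] TangentSpace (𝓡 4) x) (ε' : ℝ),
      0 < ε' →
      Metric.closedBall (extChartAt (𝓡 4) p p) ε' ⊆ (extChartAt (𝓡 4) p).target →
      (∀ x : punctured p, InPuncturedChartBall p ε' x →
        ∀ (v : TangentSpace (𝓡 4) x) (b : EuclideanSpace ℝ (Fin 4)),
          inner ℝ (fderiv ℝ inversion (extChartAt (𝓡 4) p x.1 - extChartAt (𝓡 4) p p)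
            (mfderiv (𝓡 4) 𝓘(ℝ, EuclideanSpace ℝ (Fin 4))
              (fun z : punctured p => extChartAt (𝓡 4) p z.1) x (J x v))) b
          = stdSymplecticForm (fderiv ℝ inversion (extChartAt (𝓡 4) p x.1 - extChartAt (𝓡 4) p p)
            (mfderiv (𝓡 4) 𝓘(ℝ, EuclideanSpace ℝ (Fin 4))
              (fun z : punctured p => extChartAt (𝓡 4) p z.1) x v)) b) →
      ∃ R₀ : ℝ, ∀ b : ℂ, R₀ < ‖b‖ → b ∈ interceptSet J := by
  intro S p J ε' hε' hball hJstd
  exact ⟨ε'⁻¹, fun b hb => ⟨farLine hε' hball hb, isPencilMember_farLine hε' hball hb J hJstd⟩⟩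

end Summit.SmoothPoincare4.SmoothPoincare4.Theorems.WitnessCharge.PencilIncompleteness
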